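import Literature.NumberTheory.Sieve.SmoothCountSaddle
import HarnessLib

/-!
# The local upper bound `Ψ(x', y) ≪ (x'/x)^{α(x,y)} Ψ(x, y)` (La Bretèche–Tenenbaum), polylog range

Topic `Literature/NumberTheory/Sieve`; a PROVED tool file toward
`Literature.NumberTheory.DiophantineGeometry.XYZUpperHalf` ([Harper2016, Cor. 1]). Harper's "Smooth
Numbers Result 2" (op. cit. §2.1; = R. de la Bretèche, G. Tenenbaum, *Propriétés statistiques des
entiers friables*, Ramanujan J. 9 (2005), Théorème 2.4 (i)) states: `Ψ(x/d, y) ≪ d^{-α(x,y)} Ψ(x, y)`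
uniformly for `x ≥ y ≥ 2`, `d ≥ 1`. We PROVE it in the range of the tree's saddle-point estimate
(`card_smoothNumbersUpTo_two_sided`), in the model form that the circle-method application uses:

* `log_smoothZeta_sub_ge` — **the saddle-point gain**: for `1 < x' ≤ x`, `y ≥ 2`, with
  `α = α(x, y) ≤ α' = α(x', y)`:
  `(α log x' + log ζ(α, y)) − (α' log x' + log ζ(α', y)) ≥ φ₂(α', y)(α' − α)²/2`
  (strong convexity of `g(σ) = σ log x' + log ζ(σ, y)`: `g'' = φ₂(σ, y) ≥ φ₂(α', y)` on `σ ≤ α'`,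
  `g'(α') = 0`), and `sub_saddlePoint_ge` — `α' − α ≥ log(x/x')/φ₂(α, y)` (tangent inequality).
* `card_smoothNumbersUpTo_le_model_of_le` — for `x ≥ x₀`, `(log x)^4 ≤ y`, `log y ≤ (log x)^{1/6}`
  and EVERY `1 ≤ x' ≤ x`: `Ψ(x', y) ≤ C x'^{α} ζ(α, y)/√φ₂(α, y)`, `α = α(x, y)` — Rankin's bound at
  the saddle point OF `x` keeps the `1/√φ₂` saving uniformly below `x`. (Large `x'`: the two-sided
  saddle-point estimate at `x'` and the gain against `φ₂(α)/φ₂(α') ≪ log x/log x'`; small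
  `x' < exp((log y)^5)`: the trivial bound `Ψ(x', y) ≤ x'` against `log ζ(α, y) ≥ (log x − 30)/log y`.)
* `card_smoothNumbersUpTo_le_rpow_mul_card` — **SNR2**: `Ψ(x', y) ≤ C (x'/x)^{α(x,y)} Ψ(x, y)` for
  `1 ≤ x' ≤ x` in the same range (with the lower half of the two-sided estimate at `x`).

## References

* R. de la Bretèche, G. Tenenbaum, Ramanujan J. 9 (2005) 139–202, Théorème 2.4 (i).
* A. J. Harper, Compositio Math. 152 (2016) 1121–1158, §2.1 "Smooth Numbers Result 2" [Harper2016].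
* A. Hildebrand, G. Tenenbaum, Trans. AMS 296 (1986) 265–290, Theorem 3 [HildebrandTenenbaum1986].
-/

noncomputable section

open Real Finset

namespace Literature.NumberTheory.Sieve

variable {x x' : ℝ} {y : ℕ}

/-! ### `log ζ(σ, y)` from below -/

/-- **`log ζ(σ, y) ≥ (−φ₁(σ, y) − 30)/log y`** for `σ ≥ 3/5`, `y ≥ 2`
(`−log(1 − p^{-σ}) ≥ p^{-σ} ≥ log p · p^{-σ}/log y` and the tree's `−φ₁ ≤ T + 30`). [folklore] -/
theorem saddleSum_sub_le_log_smoothZeta_mul {σ : ℝ} (hσ : 3 / 5 ≤ σ) (hy : 2 ≤ y) :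
    saddleSum σ y - 30 ≤ Real.log (smoothZeta σ y) * Real.log y := by
  have hσ0 : 0 < σ := by linarith
  have hT := saddleSum_le_sum_primesLE_log_mul_rpow_add hσ hy
  rw [log_smoothZeta hσ0, Finset.sum_mul]
  refine le_trans (by linarith) (Finset.sum_le_sum fun p hp => ?_)
  obtain ⟨hpy, hpp⟩ := Nat.mem_primesLE.1 hp
  have hp2 : (2 : ℝ) ≤ p := by exact_mod_cast hpp.two_le
  have hp0 : (0 : ℝ) < p := by linarith
  have hpy' : (p : ℝ) ≤ y := by exact_mod_cast hpy
  have hlogp : Real.log p ≤ Real.log y := Real.log_le_log hp0 hpy'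
  have ht : (p : ℝ) ^ (-σ) < 1 := Real.rpow_lt_one_of_one_lt_of_neg (by linarith) (by linarith)
  have ht0 : 0 < (p : ℝ) ^ (-σ) := Real.rpow_pos_of_pos hp0 _
  have hlog : (p : ℝ) ^ (-σ) ≤ -Real.log (1 - (p : ℝ) ^ (-σ)) := by
    have := Real.log_le_sub_one_of_pos (by linarith : 0 < 1 - (p : ℝ) ^ (-σ))
    linarith
  have hlogy0 : 0 ≤ Real.log y := le_trans (Real.log_nonneg (by linarith)) hlogp
  calc Real.log p * (p : ℝ) ^ (-σ) ≤ Real.log y * (p : ℝ) ^ (-σ) :=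
        mul_le_mul_of_nonneg_right hlogp ht0.le
    _ ≤ Real.log y * (-Real.log (1 - (p : ℝ) ^ (-σ))) := mul_le_mul_of_nonneg_left hlog hlogy0
    _ = -Real.log (1 - (p : ℝ) ^ (-σ)) * Real.log y := by ring

/-- At the saddle point: **`log ζ(α(x, y), y) ≥ (log x − 30)/log y`** (`α ≥ 3/5`, `x > 1`, `y ≥ 2`).
[cite: HildebrandTenenbaum1986, §2 (2.2)] -/
theorem log_sub_le_log_smoothZeta_saddlePoint (hx : 1 < x) (hy : 2 ≤ y)
    (hα : 3 / 5 ≤ saddlePoint x y) :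
    (Real.log x - 30) / Real.log y ≤ Real.log (smoothZeta (saddlePoint x y) y) := by
  have hlogy : 0 < Real.log y := Real.log_pos (by exact_mod_cast (lt_of_lt_of_le one_lt_two hy))
  rw [div_le_iff₀ hlogy, ← saddleSum_saddlePoint hx hy]
  exact saddleSum_sub_le_log_smoothZeta_mul hα hy

/-! ### The saddle-point gain (strong convexity of `σ log x' + log ζ(σ, y)`) -/

/-- **Strong convexity gain.** For `0 < a ≤ b` and `L` with `−φ₁(b, y) = L` (i.e. `b` is the saddle
point of `e^L`): `(a L + log ζ(a, y)) − (b L + log ζ(b, y)) ≥ φ₂(b, y)(b − a)²/2`. Proof: the function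
`H(σ) = σL + log ζ(σ, y) − φ₂(b, y)(σ − b)²/2` has `H'(σ) = L + φ₁(σ, y) − φ₂(b, y)(σ − b)
= (−φ₁(b) − φ₂(b)(σ − b)) − (−φ₁(σ)) ≤ 0` for `0 < σ ≤ b` (tangent inequality `saddleSum_sub_mul_le`),
so `H` is non-increasing on `[a, b]`. [cite: HildebrandTenenbaum1986, Thm 3 (proof)] -/
theorem log_smoothZeta_sub_ge {a b L : ℝ} (ha : 0 < a) (hab : a ≤ b) (hL : saddleSum b y = L) :
    saddlePhi₂ b y * (b - a) ^ 2 / 2 ≤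
      (a * L + Real.log (smoothZeta a y)) - (b * L + Real.log (smoothZeta b y)) := by
  have hb : 0 < b := lt_of_lt_of_le ha hab
  have hderiv : ∀ σ : ℝ, 0 < σ →
      HasDerivAt (fun s : ℝ => s * L + Real.log (smoothZeta s y) - saddlePhi₂ b y * (s - b) ^ 2 / 2)
        (L - saddleSum σ y - saddlePhi₂ b y * (σ - b)) σ := by
    intro σ hσ
    have h1 : HasDerivAt (fun s : ℝ => s * L) L σ := by
      simpa using (hasDerivAt_id σ).mul_const L
    have h2 := hasDerivAt_log_smoothZeta (y := y) hσ
    have h3' : HasDerivAt (fun s : ℝ => saddlePhi₂ b y * ((s - b) * (s - b)) / 2)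
        (saddlePhi₂ b y * (1 * (σ - b) + (σ - b) * 1) / 2) σ :=
      ((((hasDerivAt_id σ).sub_const b).mul ((hasDerivAt_id σ).sub_const b)).const_mul _).div_const 2
    have hfun : (fun s : ℝ => saddlePhi₂ b y * (s - b) ^ 2 / 2) =
        fun s => saddlePhi₂ b y * ((s - b) * (s - b)) / 2 := by
      funext s; ring
    have h3 : HasDerivAt (fun s : ℝ => saddlePhi₂ b y * (s - b) ^ 2 / 2) (saddlePhi₂ b y * (σ - b)) σ := by
      rw [hfun]
      refine h3'.congr_deriv ?_
      ring
    refine ((h1.add h2).sub h3).congr_deriv ?_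
    ring
  set H : ℝ → ℝ := fun s : ℝ => s * L + Real.log (smoothZeta s y) - saddlePhi₂ b y * (s - b) ^ 2 / 2
    with hH
  have hH'le : ∀ σ : ℝ, 0 < σ → L - saddleSum σ y - saddlePhi₂ b y * (σ - b) ≤ 0 := by
    intro σ hσ
    have ht := saddleSum_sub_mul_le (y := y) hb hσ
    rw [← hL]
    linarith
  -- `H` is antitone on `[a, b]`
  have hanti : AntitoneOn H (Set.Icc a b) := by
    refine antitoneOn_of_deriv_nonpos (convex_Icc a b) ?_ ?_ ?_
    · exact fun σ hσ => (hderiv σ (lt_of_lt_of_le ha hσ.1)).continuousAt.continuousWithinAt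
    · intro σ hσ
      rw [interior_Icc] at hσ
      exact (hderiv σ (ha.trans hσ.1)).differentiableAt.differentiableWithinAt
    · intro σ hσ
      rw [interior_Icc] at hσ
      rw [(hderiv σ (ha.trans hσ.1)).deriv]
      exact hH'le σ (ha.trans hσ.1)
  have hHab : H b ≤ H a := hanti ⟨le_rfl, hab⟩ ⟨hab, le_rfl⟩ hab
  simp only [hH] at hHab
  have h0 : (b - b) ^ 2 = 0 := by ring
  rw [h0, mul_zero, zero_div, sub_zero, show (a - b) ^ 2 = (b - a) ^ 2 by ring] at hHab
  linarith

/-- **The saddle points of `x' ≤ x` differ by at least `log(x/x')/φ₂(α(x,y), y)`**: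
`φ₂(α, y)(α' − α) ≥ log x − log x'` (tangent inequality at `α`: `−φ₁(α') ≥ −φ₁(α) − φ₂(α)(α' − α)`).
[cite: Harper2016, §2.1 (remark after (2.1))] -/
theorem log_sub_log_le_mul_sub_saddlePoint (hx' : 1 < x') (hxx' : x' ≤ x) (hy : 2 ≤ y) :
    Real.log x - Real.log x' ≤
      saddlePhi₂ (saddlePoint x y) y * (saddlePoint x' y - saddlePoint x y) := by
  have hx : 1 < x := lt_of_lt_of_le hx' hxx'
  have hα : 0 < saddlePoint x y := saddlePoint_pos hx hy
  have hα' : 0 < saddlePoint x' y := saddlePoint_pos hx' hy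
  have ht := saddleSum_sub_mul_le (y := y) (σ := saddlePoint x' y) hα hα'
  rw [saddleSum_saddlePoint hx hy, saddleSum_saddlePoint hx' hy] at ht
  linarith

/-- **The gain dominates the loss of `√φ₂`.** For `1 < x' ≤ x`, `y ≥ 2`, with `α = α(x,y)`,
`α' = α(x', y)`, `Φ = φ₂(α, y)`, `Φ' = φ₂(α', y)`:
`x'^{α'} ζ(α', y) ≤ exp(−Φ'(log x − log x')²/(2Φ²)) · x'^{α} ζ(α, y)`.
[cite: HildebrandTenenbaum1986, Thm 3 (proof)] -/
theorem rpow_mul_smoothZeta_le_exp_neg_mul (hx' : 1 < x') (hxx' : x' ≤ x) (hy : 2 ≤ y) :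
    x' ^ saddlePoint x' y * smoothZeta (saddlePoint x' y) y ≤
      Real.exp (-(saddlePhi₂ (saddlePoint x' y) y * (Real.log x - Real.log x') ^ 2 /
          (2 * saddlePhi₂ (saddlePoint x y) y ^ 2))) *
        (x' ^ saddlePoint x y * smoothZeta (saddlePoint x y) y) := by
  have hx : 1 < x := lt_of_lt_of_le hx' hxx'
  have hx'0 : 0 < x' := by linarith
  set α := saddlePoint x y with hαdef
  set α' := saddlePoint x' y with hα'def
  have hα : 0 < α := saddlePoint_pos hx hy
  have hα' : 0 < α' := saddlePoint_pos hx' hy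
  have hαα' : α ≤ α' := saddlePoint_antitone hx' hxx' hy
  have hΦ : 0 < saddlePhi₂ α y := saddlePhi₂_pos hy hα
  have hΦ' : 0 ≤ saddlePhi₂ α' y := saddlePhi₂_nonneg _ _
  -- the gain in the exponent
  have hgain := log_smoothZeta_sub_ge (y := y) hα hαα' (saddleSum_saddlePoint hx' hy)
  have hΔ := log_sub_log_le_mul_sub_saddlePoint hx' hxx' hy
  rw [← hαdef, ← hα'def] at hΔ
  have hlogxx' : 0 ≤ Real.log x - Real.log x' := by
    linarith [Real.log_le_log hx'0 hxx']
  -- `Φ'(log x - log x')²/(2Φ²) ≤ Φ'(α' - α)²/2`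
  have hexp_le : saddlePhi₂ α' y * (Real.log x - Real.log x') ^ 2 / (2 * saddlePhi₂ α y ^ 2) ≤
      saddlePhi₂ α' y * (α' - α) ^ 2 / 2 := by
    have h1 : (Real.log x - Real.log x') ^ 2 ≤ (saddlePhi₂ α y * (α' - α)) ^ 2 :=
      pow_le_pow_left₀ hlogxx' hΔ 2
    rw [div_le_div_iff₀ (by positivity) (by norm_num)]
    calc saddlePhi₂ α' y * (Real.log x - Real.log x') ^ 2 * 2
        ≤ saddlePhi₂ α' y * (saddlePhi₂ α y * (α' - α)) ^ 2 * 2 := by gcongr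
      _ = saddlePhi₂ α' y * (α' - α) ^ 2 * (2 * saddlePhi₂ α y ^ 2) := by ring
  -- exponentiate
  have hζ : 0 < smoothZeta α y := smoothZeta_pos hα
  have hζ' : 0 < smoothZeta α' y := smoothZeta_pos hα'
  have hlhs : x' ^ α' * smoothZeta α' y = Real.exp (α' * Real.log x' + Real.log (smoothZeta α' y)) := by
    rw [Real.exp_add, Real.exp_log hζ', Real.rpow_def_of_pos hx'0, mul_comm (Real.log x')]
  have hrhs : x' ^ α * smoothZeta α y = Real.exp (α * Real.log x' + Real.log (smoothZeta α y)) := by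
    rw [Real.exp_add, Real.exp_log hζ, Real.rpow_def_of_pos hx'0, mul_comm (Real.log x')]
  rw [hlhs, hrhs, ← Real.exp_add, Real.exp_le_exp]
  linarith

/-! ### The local bound in the model form -/

/-- An elementary growth lemma for the small-`x'` regime: for `A₀ ≥ 1`, `K ≥ 0` there is `L₀` with
`(A₀ + 2 log L)(K + L^{2/3}) + log L + 31 ≤ L^{5/6}` for `L ≥ L₀`. [folklore] -/
theorem exists_smallRegime_threshold {A₀ K : ℝ} (hA₀ : 1 ≤ A₀) (hK : 0 ≤ K) :
    ∃ L₀ : ℝ, 1 ≤ L₀ ∧ ∀ L : ℝ, L₀ ≤ L →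
      (A₀ + 2 * Real.log L) * (K + L ^ (2 / 3 : ℝ)) + Real.log L + 31 ≤ L ^ (5 / 6 : ℝ) := by
  obtain ⟨Y, hY1, hY⟩ := exists_log_le_mul_rpow (κ := 1 / 4) (ε := 1 / 12) (by norm_num) (by norm_num)
  set A₁ : ℝ := A₀ * (K + 1) + 1 with hA₁
  have hA₁1 : 1 ≤ A₁ := by rw [hA₁]; nlinarith
  refine ⟨max (max Y ((2 * A₁ + 62) ^ (12 : ℕ))) (2 ^ (12 : ℕ)), ?_, fun L hL => ?_⟩
  · exact le_trans hY1 ((le_max_left _ _).trans (le_max_left _ _))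
  have hLY : Y ≤ L := le_trans ((le_max_left _ _).trans (le_max_left _ _)) hL
  have hL1 : 1 ≤ L := le_trans hY1 hLY
  have hL0 : 0 < L := by linarith
  -- `z = L^{1/12} ≥ max(2, 2A₁ + 62)`
  set z : ℝ := L ^ (1 / 12 : ℝ) with hz
  have hz12 : z ^ (12 : ℕ) = L := by
    rw [hz, ← Real.rpow_natCast, ← Real.rpow_mul hL0.le]; norm_num
  have hz0 : 0 < z := Real.rpow_pos_of_pos hL0 _
  have hz_ge : ∀ w : ℝ, 0 ≤ w → w ^ (12 : ℕ) ≤ L → w ≤ z := by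
    intro w hw hwL
    by_contra hcon
    push Not at hcon
    have : z ^ (12 : ℕ) < w ^ (12 : ℕ) := pow_lt_pow_left₀ hcon hz0.le (by norm_num)
    linarith
  have hz2 : 2 ≤ z := hz_ge 2 (by norm_num) (le_trans (le_max_right _ _) hL)
  have hzA : 2 * A₁ + 62 ≤ z :=
    hz_ge _ (by linarith) (le_trans ((le_max_right _ _).trans (le_max_left _ _)) hL)
  -- the powers of `L` as powers of `z`
  have hL23 : L ^ (2 / 3 : ℝ) = z ^ (8 : ℕ) := by
    rw [hz, ← Real.rpow_natCast, ← Real.rpow_mul hL0.le]; norm_num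
  have hL56 : L ^ (5 / 6 : ℝ) = z ^ (10 : ℕ) := by
    rw [hz, ← Real.rpow_natCast, ← Real.rpow_mul hL0.le]; norm_num
  have hlogL : Real.log L ≤ z / 4 := by
    have := hY L hLY; rw [← hz] at this; linarith
  have hlogL0 : 0 ≤ Real.log L := Real.log_nonneg hL1
  rw [hL23, hL56]
  -- `(A₀ + 2 log L) ≤ A₀ z`, `K + z^8 ≤ (K+1) z^8`
  have h1 : A₀ + 2 * Real.log L ≤ A₀ * z := by nlinarith
  have hz8 : 1 ≤ z ^ (8 : ℕ) := one_le_pow₀ (by linarith)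
  have h2 : K + z ^ (8 : ℕ) ≤ (K + 1) * z ^ (8 : ℕ) := by nlinarith
  have h3 : (A₀ + 2 * Real.log L) * (K + z ^ (8 : ℕ)) ≤ (A₀ * z) * ((K + 1) * z ^ (8 : ℕ)) :=
    mul_le_mul h1 h2 (by positivity) (by positivity)
  have h4 : Real.log L + 31 ≤ z + 31 := by linarith
  -- `A₀ (K+1) z^9 + z + 31 ≤ z^10` as `z ≥ 2A₁ + 62`
  have hz9 : z ≤ z ^ (9 : ℕ) := by
    calc z = z ^ 1 := (pow_one z).symm
      _ ≤ z ^ (9 : ℕ) := pow_le_pow_right₀ (by linarith) (by norm_num)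
  have hz9' : (1 : ℝ) ≤ z ^ (9 : ℕ) := one_le_pow₀ (by linarith)
  calc (A₀ + 2 * Real.log L) * (K + z ^ (8 : ℕ)) + Real.log L + 31
      ≤ (A₀ * z) * ((K + 1) * z ^ (8 : ℕ)) + (z + 31) := by linarith
    _ = (A₁ - 1) * z ^ (9 : ℕ) + z + 31 := by rw [hA₁]; ring
    _ ≤ (A₁ - 1) * z ^ (9 : ℕ) + z ^ (9 : ℕ) + 31 * z ^ (9 : ℕ) := by nlinarith
    _ = (A₁ + 31) * z ^ (9 : ℕ) := by ring
    _ ≤ (z / 2) * z ^ (9 : ℕ) := by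
        apply mul_le_mul_of_nonneg_right _ (by positivity); linarith
    _ ≤ z ^ (10 : ℕ) := by rw [pow_succ]; nlinarith [pow_pos hz0 9]

set_option maxHeartbeats 1600000 in
-- a long case analysis with a large context
/-- **`Ψ(x', y) ≤ C x'^{α(x,y)} ζ(α(x,y), y)/√φ₂(α(x,y), y)` uniformly for `1 ≤ x' ≤ x`**, in the
range `x ≥ x₀`, `(log x)^4 ≤ y`, `log y ≤ (log x)^{1/6}` (which contains `y = logᴷ x`, `K ≥ 4`).
For `x' ≥ max(x₁, exp((log y)^5))` (`x₁` an absolute threshold) this is the two-sided saddle-point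
estimate at `x'` (`card_smoothNumbersUpTo_two_sided`), Rankin at the saddle point of `x`
corrected by the gain `rpow_mul_smoothZeta_le_exp_neg_mul` against `φ₂(α(x))/φ₂(α(x')) ≤
(3/c) log x/log x'`; for smaller `x'` it is the trivial bound `Ψ(x', y) ≤ x'` against
`log ζ(α, y) ≥ (log x − 30)/log y` and `(1 − α) log x' ≪ (log log x)(log y)^4`.
[cite: Harper2016, §2.1 (Smooth Numbers Result 2)] [cite: HildebrandTenenbaum1986, Thm 3] -/
theorem card_smoothNumbersUpTo_le_model_of_le :
    ∃ C x₀ : ℝ, 0 < C ∧ ∀ (x : ℝ) (y : ℕ), x₀ ≤ x → Real.log x ^ 4 ≤ y →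
      Real.log y ≤ Real.log x ^ (1 / 6 : ℝ) → ∀ x' : ℝ, 1 ≤ x' → x' ≤ x →
        (#(Nat.smoothNumbersUpTo ⌊x'⌋₊ (y + 1)) : ℝ) ≤
          C * (x' ^ saddlePoint x y * smoothZeta (saddlePoint x y) y /
            Real.sqrt (saddlePhi₂ (saddlePoint x y) y)) := by
  classical
  obtain ⟨x₀B, hB⟩ := card_smoothNumbersUpTo_two_sided
  obtain ⟨x₀U, hU⟩ := saddlePhi₂_saddlePoint_le
  obtain ⟨c, x₀L, hc, hLφ⟩ := le_saddlePhi₂_saddlePoint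
  obtain ⟨x₀T, h35⟩ := three_fifths_le_saddlePoint
  obtain ⟨C_A, x₀A, hCA, hA⟩ := rpow_one_sub_saddlePoint_le
  -- absolute thresholds
  set X : ℝ := max (max (max x₀B x₀U) (max x₀L x₀T)) (max x₀A (Real.exp 1)) with hXdef
  have hX_B : x₀B ≤ X := le_trans (le_trans (le_max_left _ _) (le_max_left _ _)) (le_max_left _ _)
  have hX_U : x₀U ≤ X := le_trans (le_trans (le_max_right _ _) (le_max_left _ _)) (le_max_left _ _)
  have hX_L : x₀L ≤ X := le_trans (le_trans (le_max_left _ _) (le_max_right _ _)) (le_max_left _ _)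
  have hX_T : x₀T ≤ X := le_trans (le_trans (le_max_right _ _) (le_max_right _ _)) (le_max_left _ _)
  have hX_A : x₀A ≤ X := le_trans (le_max_left _ _) (le_max_right _ _)
  have hX_e : Real.exp 1 ≤ X := le_trans (le_max_right _ _) (le_max_right _ _)
  have hX1 : 1 ≤ X := le_trans (by have := Real.add_one_le_exp (1 : ℝ); linarith) hX_e
  have hX0 : 0 < X := by linarith
  set Kc : ℝ := Real.log X with hKc
  have hKc0 : 0 ≤ Kc := Real.log_nonneg hX1
  -- the small-regime threshold
  set A₀ : ℝ := |Real.log C_A| + 1 with hA₀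
  have hA₀1 : 1 ≤ A₀ := by rw [hA₀]; have := abs_nonneg (Real.log C_A); linarith
  obtain ⟨L₁, hL₁1, hsmall⟩ := exists_smallRegime_threshold hA₀1 hKc0
  -- the constant and the threshold
  set C : ℝ := max (3 * Real.sqrt (6 / c)) 1 with hCdef
  have hC1 : 1 ≤ C := le_max_right _ _
  have hC0 : 0 < C := by linarith
  have hCc : 3 * Real.sqrt (6 / c) ≤ C := le_max_left _ _
  set L₀ : ℝ := max (max L₁ 64) (max (Real.exp ((9 / c) ^ (1 / 3 : ℝ) / 4 + 1)) Kc) with hL₀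
  refine ⟨C, max X (Real.exp L₀), hC0, fun x y hx hy4 hy6 x' hx'1 hx'x => ?_⟩
  ------------------------------------------------------------------
  -- ### the range at `x`
  have hxX : X ≤ x := le_trans (le_max_left _ _) hx
  have hexp1 : (2 : ℝ) ≤ Real.exp 1 := by have := Real.add_one_le_exp (1 : ℝ); linarith
  have hx1 : 1 < x := by linarith
  have hx0 : 0 < x := by linarith
  set L : ℝ := Real.log x with hLdef
  have hLL₀ : L₀ ≤ L := by
    have := Real.log_le_log (Real.exp_pos _) (le_trans (le_max_right _ _) hx)
    rwa [Real.log_exp] at this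
  have hL₁L : L₁ ≤ L := le_trans ((le_max_left _ _).trans (le_max_left _ _)) hLL₀
  have hL64 : 64 ≤ L := le_trans ((le_max_right _ _).trans (le_max_left _ _)) hLL₀
  have hL9c : (9 / c) ^ (1 / 3 : ℝ) / 4 + 1 ≤ Real.log L := by
    have h1 : Real.exp ((9 / c) ^ (1 / 3 : ℝ) / 4 + 1) ≤ L :=
      le_trans ((le_max_left _ _).trans (le_max_right _ _)) hLL₀
    have := Real.log_le_log (Real.exp_pos _) h1
    rwa [Real.log_exp] at this
  have hKcL : Kc ≤ L := le_trans ((le_max_right _ _).trans (le_max_right _ _)) hLL₀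
  have hL1 : 1 ≤ L := by linarith
  have hL0 : 0 < L := by linarith
  have hlogL0 : 0 ≤ Real.log L := Real.log_nonneg hL1
  -- `ℓ = log y ≥ 16`
  have hy_ge : L ^ 4 ≤ y := hy4
  have hL34 : L ^ 3 ≤ L ^ 4 := pow_le_pow_right₀ hL1 (by norm_num)
  have hyL : L ≤ y := by
    calc L = L ^ 1 := (pow_one L).symm
      _ ≤ L ^ 4 := pow_le_pow_right₀ hL1 (by norm_num)
      _ ≤ y := hy_ge
  have hy2r : (2 : ℝ) ≤ y := by linarith
  have hy2 : 2 ≤ y := by exact_mod_cast hy2r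
  have hy0 : (0 : ℝ) < y := by linarith
  set ℓ : ℝ := Real.log y with hℓdef
  have hℓ4L : 4 * Real.log L ≤ ℓ := by
    have := Real.log_le_log (by positivity) hy_ge
    rwa [Real.log_pow, Nat.cast_ofNat] at this
  have hℓL6 : ℓ ≤ L ^ (1 / 6 : ℝ) := hy6
  have hlog64 : 4 ≤ Real.log 64 := by
    rw [show (64 : ℝ) = 2 ^ 6 by norm_num, Real.log_pow, Nat.cast_ofNat]
    have := Real.log_two_gt_d9
    linarith
  have hlogL4 : 4 ≤ Real.log L := le_trans hlog64 (Real.log_le_log (by norm_num) hL64)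
  have hℓ16 : 16 ≤ ℓ := by linarith
  have hℓ1 : 1 ≤ ℓ := by linarith
  have hℓ0 : 0 < ℓ := by linarith
  have hL16 : L ^ (1 / 6 : ℝ) ≤ L := by
    calc L ^ (1 / 6 : ℝ) ≤ L ^ (1 : ℝ) := Real.rpow_le_rpow_of_exponent_le hL1 (by norm_num)
      _ = L := Real.rpow_one L
  have hℓL : ℓ ≤ L := hℓL6.trans hL16
  have hyx : (y : ℝ) ≤ x := by
    rw [← Real.exp_log hy0, ← Real.exp_log hx0]
    exact Real.exp_le_exp.mpr hℓL
  have hy3 : Real.log x ^ 3 ≤ y := le_trans hL34 hy_ge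
  -- ### facts at the saddle point of `x`
  set α : ℝ := saddlePoint x y with hαdef
  set Φ : ℝ := saddlePhi₂ α y with hΦdef
  have hα35 : 3 / 5 ≤ α := h35 x y (hX_T.trans hxX) hy3 hyx
  have hα0 : 0 < α := by linarith
  have hΦU : Φ ≤ 3 * L * ℓ := hU x y (hX_U.trans hxX) hy3 hyx
  have hΦL : c * (L * ℓ) ≤ Φ := hLφ x y (hX_L.trans hxX) hy3 hyx
  have hΦ0 : 0 < Φ := lt_of_lt_of_le (by positivity) hΦL
  have hζ0 : 0 < smoothZeta α y := smoothZeta_pos hα0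
  have hx'0 : 0 < x' := by linarith
  set M : ℝ := x' ^ α * smoothZeta α y with hMdef
  have hM0 : 0 < M := by positivity
  have hsqΦ : 0 < Real.sqrt Φ := Real.sqrt_pos.mpr hΦ0
  ------------------------------------------------------------------
  by_cases hbig : max X (Real.exp (ℓ ^ 5)) ≤ x'
  · -- ### Case I: large `x'` — the saddle-point estimate at `x'` and the gain
    have hx'X : X ≤ x' := le_trans (le_max_left _ _) hbig
    have hx'exp : Real.exp (ℓ ^ 5) ≤ x' := le_trans (le_max_right _ _) hbig
    have hx'1 : 1 < x' := by linarith [hX_e]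
    set L' : ℝ := Real.log x' with hL'def
    have hL'ℓ5 : ℓ ^ 5 ≤ L' := by
      have := Real.log_le_log (Real.exp_pos _) hx'exp
      rwa [Real.log_exp] at this
    have hL'L : L' ≤ L := Real.log_le_log hx'0 hx'x
    have hℓ5 : ℓ ≤ ℓ ^ 5 := by
      calc ℓ = ℓ ^ 1 := (pow_one ℓ).symm
        _ ≤ ℓ ^ 5 := pow_le_pow_right₀ hℓ1 (by norm_num)
    have hℓL' : ℓ ≤ L' := hℓ5.trans hL'ℓ5
    have hL'1 : 1 ≤ L' := hℓ1.trans hℓL'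
    have hL'0 : 0 < L' := by linarith
    have hyx' : (y : ℝ) ≤ x' := by
      rw [← Real.exp_log hy0, ← Real.exp_log hx'0]
      exact Real.exp_le_exp.mpr hℓL'
    have hy3' : Real.log x' ^ 3 ≤ y := by
      calc Real.log x' ^ 3 ≤ L ^ 3 := pow_le_pow_left₀ hL'0.le hL'L 3
        _ ≤ y := hy3
    have hy4' : Real.log x' ^ 4 ≤ y := by
      calc Real.log x' ^ 4 ≤ L ^ 4 := pow_le_pow_left₀ hL'0.le hL'L 4
        _ ≤ y := hy_ge
    have hy5' : Real.log y ≤ Real.log x' ^ (1 / 5 : ℝ) := by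
      have hℓ55 : (ℓ ^ 5) ^ (1 / 5 : ℝ) = ℓ := by
        rw [← Real.rpow_natCast, ← Real.rpow_mul hℓ0.le]; norm_num
      calc Real.log y = ℓ := hℓdef.symm
        _ = (ℓ ^ 5) ^ (1 / 5 : ℝ) := hℓ55.symm
        _ ≤ L' ^ (1 / 5 : ℝ) := Real.rpow_le_rpow (by positivity) hL'ℓ5 (by norm_num)
    -- the estimate at `x'`
    obtain ⟨-, hΨ'⟩ := hB x' y (hX_B.trans hx'X) hy4' hy5'
    set α' : ℝ := saddlePoint x' y with hα'def
    set Φ' : ℝ := saddlePhi₂ α' y with hΦ'def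
    have hΦ'L : c * (L' * ℓ) ≤ Φ' := hLφ x' y (hX_L.trans hx'X) hy3' hyx'
    have hΦ'0 : 0 < Φ' := lt_of_lt_of_le (by positivity) hΦ'L
    have hsqΦ' : 0 < Real.sqrt Φ' := Real.sqrt_pos.mpr hΦ'0
    -- the gain
    have hgain := rpow_mul_smoothZeta_le_exp_neg_mul hx'1 hx'x hy2
    rw [← hαdef, ← hα'def, ← hΦdef, ← hΦ'def, ← hMdef, ← hLdef, ← hL'def] at hgain
    set G₀ : ℝ := Φ' * (L - L') ^ 2 / (2 * Φ ^ 2) with hG₀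
    have hG₀0 : 0 ≤ G₀ := by rw [hG₀]; positivity
    -- `3 √Φ ≤ C e^{G₀} √Φ'`
    have key : 3 * Real.sqrt Φ ≤ C * Real.exp G₀ * Real.sqrt Φ' := by
      have hsqrt6c : 0 < Real.sqrt (6 / c) := Real.sqrt_pos.mpr (by positivity)
      have h6c : Real.sqrt (6 / c) * Real.sqrt (c * (L' * ℓ)) = Real.sqrt (6 * (L' * ℓ)) := by
        rw [← Real.sqrt_mul (by positivity)]
        congr 1; field_simp
      rcases le_total (L / 2) L' with hhalf | hhalf
      · -- `L' ≥ L/2`: `√Φ ≤ √(3Lℓ) ≤ √(6L'ℓ) = √(6/c) √(cL'ℓ) ≤ √(6/c) √Φ'`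
        have hΦ6 : Φ ≤ 6 * (L' * ℓ) := by
          calc Φ ≤ 3 * L * ℓ := hΦU
            _ ≤ 3 * (2 * L') * ℓ := by gcongr; linarith
            _ = 6 * (L' * ℓ) := by ring
        have h1 : Real.sqrt Φ ≤ Real.sqrt (6 / c) * Real.sqrt Φ' := by
          calc Real.sqrt Φ ≤ Real.sqrt (6 * (L' * ℓ)) := Real.sqrt_le_sqrt hΦ6
            _ = Real.sqrt (6 / c) * Real.sqrt (c * (L' * ℓ)) := h6c.symm
            _ ≤ Real.sqrt (6 / c) * Real.sqrt Φ' :=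
                mul_le_mul_of_nonneg_left (Real.sqrt_le_sqrt hΦ'L) hsqrt6c.le
        have h2 : (1 : ℝ) ≤ Real.exp G₀ := Real.one_le_exp hG₀0
        calc 3 * Real.sqrt Φ ≤ 3 * (Real.sqrt (6 / c) * Real.sqrt Φ') := by linarith
          _ = (3 * Real.sqrt (6 / c)) * 1 * Real.sqrt Φ' := by ring
          _ ≤ C * Real.exp G₀ * Real.sqrt Φ' :=
              mul_le_mul_of_nonneg_right (mul_le_mul hCc h2 (by norm_num) hC0.le) hsqΦ'.le
      · -- `L' ≤ L/2`: the gain `G₀ ≥ c ℓ⁴/72 ≥ log L/2` gives `e^{G₀} ≥ √L`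
        have hℓ3 : 9 / c ≤ ℓ ^ 3 := by
          have h1 : (9 / c) ^ (1 / 3 : ℝ) ≤ ℓ := by linarith
          calc 9 / c = ((9 / c) ^ (1 / 3 : ℝ)) ^ (3 : ℕ) := by
                rw [← Real.rpow_natCast, ← Real.rpow_mul (by positivity)]; norm_num
            _ ≤ ℓ ^ 3 := pow_le_pow_left₀ (by positivity) h1 3
        have hG₀ge : Real.log L / 2 ≤ G₀ := by
          -- `G₀ ≥ c ℓ⁶ (L²/4)/(18 L² ℓ²) = c ℓ⁴/72 ≥ (9/c)(4 log L) c/72 = log L/2`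
          have hΦ'6 : c * ℓ ^ 6 ≤ Φ' := by
            calc c * ℓ ^ 6 = c * (ℓ ^ 5 * ℓ) := by ring
              _ ≤ c * (L' * ℓ) := by gcongr
              _ ≤ Φ' := hΦ'L
          have hLL' : L ^ 2 / 4 ≤ (L - L') ^ 2 := by
            have h := pow_le_pow_left₀ (by positivity : 0 ≤ L / 2) (by linarith : L / 2 ≤ L - L') 2
            calc L ^ 2 / 4 = (L / 2) ^ 2 := by ring
              _ ≤ (L - L') ^ 2 := h
          have hΦsq : Φ ^ 2 ≤ 9 * L ^ 2 * ℓ ^ 2 := by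
            calc Φ ^ 2 ≤ (3 * L * ℓ) ^ 2 := pow_le_pow_left₀ hΦ0.le hΦU 2
              _ = 9 * L ^ 2 * ℓ ^ 2 := by ring
          have h1 : c * ℓ ^ 4 / 72 ≤ G₀ := by
            rw [hG₀, div_le_div_iff₀ (by norm_num) (by positivity)]
            calc c * ℓ ^ 4 * (2 * Φ ^ 2) ≤ c * ℓ ^ 4 * (2 * (9 * L ^ 2 * ℓ ^ 2)) := by gcongr
              _ = (c * ℓ ^ 6) * (L ^ 2 / 4) * 72 := by ring
              _ ≤ Φ' * (L - L') ^ 2 * 72 := by gcongr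
          have h2 : Real.log L / 2 ≤ c * ℓ ^ 4 / 72 := by
            have h9 : 9 ≤ c * ℓ ^ 3 := (div_le_iff₀' hc).mp hℓ3
            have h3 : 36 * Real.log L ≤ c * ℓ ^ 4 := by
              calc 36 * Real.log L = 9 * (4 * Real.log L) := by ring
                _ ≤ (c * ℓ ^ 3) * ℓ := mul_le_mul h9 hℓ4L (by positivity) (by positivity)
                _ = c * ℓ ^ 4 := by ring
            linarith
          linarith
        have hexpG : Real.sqrt L ≤ Real.exp G₀ := by
          calc Real.sqrt L = Real.exp (Real.log L / 2) := by
                rw [Real.sqrt_eq_rpow, Real.rpow_def_of_pos hL0]; ring_nf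
            _ ≤ Real.exp G₀ := Real.exp_le_exp.mpr hG₀ge
        -- `3 √Φ ≤ 3 √3 √L √ℓ ≤ 3 √(6/c) √L √(c L' ℓ)`
        have h1 : Real.sqrt Φ ≤ Real.sqrt 3 * Real.sqrt L * Real.sqrt ℓ := by
          rw [← Real.sqrt_mul (by norm_num), ← Real.sqrt_mul (by positivity)]
          exact Real.sqrt_le_sqrt (by linarith)
        have h2 : Real.sqrt 3 * Real.sqrt ℓ ≤ Real.sqrt (6 / c) * Real.sqrt Φ' := by
          calc Real.sqrt 3 * Real.sqrt ℓ ≤ Real.sqrt 6 * Real.sqrt (L' * ℓ) :=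
                mul_le_mul (Real.sqrt_le_sqrt (by norm_num))
                  (Real.sqrt_le_sqrt (le_mul_of_one_le_left hℓ0.le hL'1))
                  (Real.sqrt_nonneg _) (Real.sqrt_nonneg _)
            _ = Real.sqrt (6 * (L' * ℓ)) := (Real.sqrt_mul (by norm_num) _).symm
            _ = Real.sqrt (6 / c) * Real.sqrt (c * (L' * ℓ)) := h6c.symm
            _ ≤ Real.sqrt (6 / c) * Real.sqrt Φ' :=
                mul_le_mul_of_nonneg_left (Real.sqrt_le_sqrt hΦ'L) hsqrt6c.le
        calc 3 * Real.sqrt Φ ≤ 3 * (Real.sqrt 3 * Real.sqrt L * Real.sqrt ℓ) := by linarith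
          _ = 3 * (Real.sqrt 3 * Real.sqrt ℓ) * Real.sqrt L := by ring
          _ ≤ 3 * (Real.sqrt (6 / c) * Real.sqrt Φ') * Real.exp G₀ :=
              mul_le_mul (mul_le_mul_of_nonneg_left h2 (by norm_num)) hexpG (Real.sqrt_nonneg _)
                (by positivity)
          _ = (3 * Real.sqrt (6 / c)) * Real.exp G₀ * Real.sqrt Φ' := by ring
          _ ≤ C * Real.exp G₀ * Real.sqrt Φ' :=
              mul_le_mul_of_nonneg_right (mul_le_mul_of_nonneg_right hCc (by positivity)) hsqΦ'.le
    -- conclude Case I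
    have hstep : 3 * (x' ^ α' * smoothZeta α' y / Real.sqrt Φ') ≤ C * (M / Real.sqrt Φ) := by
      have h1 : 3 * (x' ^ α' * smoothZeta α' y / Real.sqrt Φ') ≤ 3 * (Real.exp (-G₀) * M / Real.sqrt Φ') := by
        gcongr
      refine h1.trans ?_
      rw [Real.exp_neg]
      rw [show 3 * ((Real.exp G₀)⁻¹ * M / Real.sqrt Φ') = M * (3 / (Real.exp G₀ * Real.sqrt Φ')) by
        field_simp]
      rw [show C * (M / Real.sqrt Φ) = M * (C / Real.sqrt Φ) by ring]
      refine mul_le_mul_of_nonneg_left ?_ hM0.le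
      rw [div_le_div_iff₀ (by positivity) hsqΦ]
      linarith [key]
    exact hΨ'.trans hstep
  · -- ### Case II: small `x'` — the trivial bound
    push Not at hbig
    have hΨtriv : (#(Nat.smoothNumbersUpTo ⌊x'⌋₊ (y + 1)) : ℝ) ≤ x' := by
      have h1 : #(Nat.smoothNumbersUpTo ⌊x'⌋₊ (y + 1)) ≤ ⌊x'⌋₊ := by
        have hsub : Nat.smoothNumbersUpTo ⌊x'⌋₊ (y + 1) ⊆ Finset.Icc 1 ⌊x'⌋₊ := by
          intro n hn
          rw [Nat.mem_smoothNumbersUpTo] at hn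
          rw [Finset.mem_Icc]
          exact ⟨Nat.pos_of_ne_zero hn.2.1, hn.1⟩
        have := Finset.card_le_card hsub
        simpa using this
      calc (#(Nat.smoothNumbersUpTo ⌊x'⌋₊ (y + 1)) : ℝ) ≤ ⌊x'⌋₊ := by exact_mod_cast h1
        _ ≤ x' := Nat.floor_le hx'0.le
    refine hΨtriv.trans ?_
    -- it suffices that `x'^{1-α} √Φ ≤ ζ(α, y)`
    suffices hsuff : x' ^ (1 - α) * Real.sqrt Φ ≤ smoothZeta α y by
      have h1 : x' ≤ M / Real.sqrt Φ := by
        rw [le_div_iff₀ hsqΦ, hMdef]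
        calc x' * Real.sqrt Φ = x' ^ α * (x' ^ (1 - α) * Real.sqrt Φ) := by
              rw [← mul_assoc, ← Real.rpow_add hx'0]; norm_num
          _ ≤ x' ^ α * smoothZeta α y := mul_le_mul_of_nonneg_left hsuff (by positivity)
      calc x' ≤ M / Real.sqrt Φ := h1
        _ = 1 * (M / Real.sqrt Φ) := (one_mul _).symm
        _ ≤ C * (M / Real.sqrt Φ) := mul_le_mul_of_nonneg_right hC1 (by positivity)
    -- logarithmic form: `(1-α) log x' + log √Φ ≤ log ζ(α, y)`
    have hlogζ : L ^ (5 / 6 : ℝ) - 30 ≤ Real.log (smoothZeta α y) := by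
      have h1 := log_sub_le_log_smoothZeta_saddlePoint hx1 hy2 (by rw [← hαdef]; exact hα35)
      rw [← hαdef, ← hLdef, ← hℓdef] at h1
      have h2 : L ^ (5 / 6 : ℝ) ≤ L / ℓ := by
        rw [le_div_iff₀ hℓ0]
        calc L ^ (5 / 6 : ℝ) * ℓ ≤ L ^ (5 / 6 : ℝ) * L ^ (1 / 6 : ℝ) := by gcongr
          _ = L := by rw [← Real.rpow_add hL0]; norm_num
      have h3 : L / ℓ - 30 ≤ (L - 30) / ℓ := by
        rw [sub_div]
        have : 30 / ℓ ≤ 30 := div_le_self (by norm_num) hℓ1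
        linarith
      linarith
    -- (a) `(1 - α) log x' ≤ (A₀ + 2 log L)(Kc + L^{2/3})`
    have hlogx'0 : 0 ≤ Real.log x' := Real.log_nonneg hx'1
    have hlogx₁ : Real.log x' ≤ Kc + ℓ ^ 5 := by
      have hx₁0 : 0 < max X (Real.exp (ℓ ^ 5)) := lt_of_lt_of_le hX0 (le_max_left _ _)
      have h1 : Real.log x' ≤ Real.log (max X (Real.exp (ℓ ^ 5))) := Real.log_le_log hx'0 hbig.le
      have h2 : Real.log (max X (Real.exp (ℓ ^ 5))) ≤ Kc + ℓ ^ 5 := by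
        rcases le_total X (Real.exp (ℓ ^ 5)) with h | h
        · rw [max_eq_right h, Real.log_exp]; linarith
        · rw [max_eq_left h, hKc]; linarith [pow_pos hℓ0 5]
      linarith
    have ha : (1 - α) * Real.log x' ≤ (A₀ + 2 * Real.log L) * (Kc + L ^ (2 / 3 : ℝ)) := by
      have hKcL23 : 0 ≤ Kc + L ^ (2 / 3 : ℝ) := by positivity
      have hA₀L : 0 ≤ A₀ + 2 * Real.log L := by linarith
      rcases le_total (1 - α) 0 with hβ | hβ
      · calc (1 - α) * Real.log x' ≤ 0 := mul_nonpos_of_nonpos_of_nonneg hβ hlogx'0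
          _ ≤ _ := mul_nonneg hA₀L hKcL23
      · -- `(1-α) ℓ ≤ log(C_A u log(u+1)) ≤ |log C_A| + 2 log L`
        have hyA := hA x y (hX_A.trans hxX) hy3 hyx
        rw [← hαdef, ← hLdef, ← hℓdef] at hyA
        set u : ℝ := L / ℓ with hu
        have hu1 : 1 ≤ u := by rw [hu, le_div_iff₀ hℓ0]; linarith
        have huL : u ≤ L := div_le_self hL0.le hℓ1
        have hlogu : Real.log (u + 1) ≤ L := by
          have := Real.log_le_sub_one_of_pos (by linarith : 0 < u + 1)
          linarith
        have hprod : C_A * (u * Real.log (u + 1)) ≤ C_A * (L * L) := by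
          refine mul_le_mul_of_nonneg_left ?_ hCA.le
          exact mul_le_mul huL hlogu (Real.log_nonneg (by linarith)) hL0.le
        have hprod0 : 0 < C_A * (u * Real.log (u + 1)) := by
          have : 0 < Real.log (u + 1) := Real.log_pos (by linarith)
          positivity
        have hβℓ : (1 - α) * ℓ ≤ |Real.log C_A| + 2 * Real.log L := by
          have h1 : Real.log ((y : ℝ) ^ (1 - α)) ≤ Real.log (C_A * (u * Real.log (u + 1))) :=
            Real.log_le_log (Real.rpow_pos_of_pos hy0 _) hyA
          rw [Real.log_rpow hy0] at h1
          have h2 : Real.log (C_A * (u * Real.log (u + 1))) ≤ Real.log (C_A * (L * L)) :=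
            Real.log_le_log hprod0 hprod
          have hul0 : 0 < u * Real.log (u + 1) := by
            have := Real.log_pos (by linarith : 1 < u + 1); positivity
          rw [Real.log_mul hCA.ne' hul0.ne', Real.log_mul hCA.ne' (mul_pos hL0 hL0).ne',
            Real.log_mul hL0.ne' hL0.ne'] at h2
          rw [Real.log_mul hCA.ne' hul0.ne'] at h1
          have h3 : Real.log C_A ≤ |Real.log C_A| := le_abs_self _
          rw [hℓdef]
          linarith
        -- `(1-α) log x' ≤ (1-α)(Kc + ℓ^5) ≤ ((1-α)ℓ)(Kc + ℓ^4)`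
        have hKcℓ : Kc ≤ ℓ * Kc := le_mul_of_one_le_left hKc0 hℓ1
        calc (1 - α) * Real.log x' ≤ (1 - α) * (Kc + ℓ ^ 5) := mul_le_mul_of_nonneg_left hlogx₁ hβ
          _ = (1 - α) * Kc + (1 - α) * ℓ ^ 5 := by ring
          _ ≤ (1 - α) * (ℓ * Kc) + (1 - α) * ℓ ^ 5 := by gcongr
          _ = ((1 - α) * ℓ) * (Kc + ℓ ^ 4) := by ring
          _ ≤ (|Real.log C_A| + 2 * Real.log L) * (Kc + ℓ ^ 4) :=
              mul_le_mul_of_nonneg_right hβℓ (by positivity)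
          _ ≤ (A₀ + 2 * Real.log L) * (Kc + L ^ (2 / 3 : ℝ)) := by
              have hℓ4 : ℓ ^ 4 ≤ L ^ (2 / 3 : ℝ) := by
                calc ℓ ^ 4 ≤ (L ^ (1 / 6 : ℝ)) ^ (4 : ℕ) := pow_le_pow_left₀ hℓ0.le hℓL6 4
                  _ = L ^ (2 / 3 : ℝ) := by
                      rw [← Real.rpow_natCast, ← Real.rpow_mul hL0.le]; norm_num
              have hA₀' : |Real.log C_A| + 2 * Real.log L ≤ A₀ + 2 * Real.log L := by
                rw [hA₀]; linarith
              have hK' : Kc + ℓ ^ 4 ≤ Kc + L ^ (2 / 3 : ℝ) := by linarith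
              exact mul_le_mul hA₀' hK' (by positivity) hA₀L
    -- (b) `log √Φ ≤ 1 + log L`
    have hb : Real.log (Real.sqrt Φ) ≤ 1 + Real.log L := by
      rw [Real.log_sqrt hΦ0.le]
      have h1 : Real.log Φ ≤ Real.log (3 * L * L) :=
        Real.log_le_log hΦ0 (hΦU.trans (mul_le_mul_of_nonneg_left hℓL (by positivity)))
      rw [Real.log_mul (by positivity) hL0.ne', Real.log_mul (by norm_num) hL0.ne'] at h1
      have h3 : Real.log 3 ≤ 2 := by
        have := Real.log_le_sub_one_of_pos (by norm_num : (0 : ℝ) < 3); linarith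
      linarith
    -- (c) assemble in the exponent
    have hsm := hsmall L hL₁L
    have hexp : (1 - α) * Real.log x' + Real.log (Real.sqrt Φ) ≤ Real.log (smoothZeta α y) := by
      linarith only [ha, hb, hsm, hlogζ]
    calc x' ^ (1 - α) * Real.sqrt Φ
        = Real.exp ((1 - α) * Real.log x' + Real.log (Real.sqrt Φ)) := by
          rw [Real.exp_add, Real.exp_log hsqΦ, Real.rpow_def_of_pos hx'0, mul_comm (Real.log x')]
      _ ≤ Real.exp (Real.log (smoothZeta α y)) := Real.exp_le_exp.mpr hexp
      _ = smoothZeta α y := Real.exp_log hζ0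

/-- **Smooth Numbers Result 2 (La Bretèche–Tenenbaum Théorème 2.4 (i), polylog range):
`Ψ(x', y) ≤ C (x'/x)^{α(x,y)} Ψ(x, y)`** for `x ≥ x₀`, `(log x)^4 ≤ y`, `log y ≤ (log x)^{1/6}` and
all `1 ≤ x' ≤ x` (equivalently `Ψ(x/d, y) ≤ C d^{-α} Ψ(x, y)`, `1 ≤ d ≤ x`). Printed: uniformly for
`x ≥ y ≥ 2`; TODO(general form). [cite: Harper2016, §2.1 (Smooth Numbers Result 2)] -/
theorem card_smoothNumbersUpTo_le_rpow_mul_card :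
    ∃ C x₀ : ℝ, 0 < C ∧ ∀ (x : ℝ) (y : ℕ), x₀ ≤ x → Real.log x ^ 4 ≤ y →
      Real.log y ≤ Real.log x ^ (1 / 6 : ℝ) → ∀ x' : ℝ, 1 ≤ x' → x' ≤ x →
        (#(Nat.smoothNumbersUpTo ⌊x'⌋₊ (y + 1)) : ℝ) ≤
          C * (x' / x) ^ saddlePoint x y * #(Nat.smoothNumbersUpTo ⌊x⌋₊ (y + 1)) := by
  obtain ⟨C, x₀, hC, hM⟩ := card_smoothNumbersUpTo_le_model_of_le
  obtain ⟨x₀B, hB⟩ := card_smoothNumbersUpTo_two_sided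
  refine ⟨50 * C, max (max x₀ x₀B) 3, by positivity, fun x y hx hy4 hy6 x' hx'1 hx'x => ?_⟩
  have hx₀ : x₀ ≤ x := le_trans ((le_max_left _ _).trans (le_max_left _ _)) hx
  have hx₀B : x₀B ≤ x := le_trans ((le_max_right _ _).trans (le_max_left _ _)) hx
  have hx3 : 3 ≤ x := le_trans (le_max_right _ _) hx
  have hx0 : 0 < x := by linarith
  have hx'0 : 0 < x' := by linarith
  have hL1 : 1 ≤ Real.log x := by
    rw [Real.le_log_iff_exp_le hx0]
    have := Real.exp_one_lt_d9; linarith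
  have hy5 : Real.log y ≤ Real.log x ^ (1 / 5 : ℝ) :=
    hy6.trans (Real.rpow_le_rpow_of_exponent_le hL1 (by norm_num))
  obtain ⟨hlow, -⟩ := hB x y hx₀B hy4 hy5
  have h1 := hM x y hx₀ hy4 hy6 x' hx'1 hx'x
  set α := saddlePoint x y with hα
  set T : ℝ := x ^ α * smoothZeta α y / Real.sqrt (saddlePhi₂ α y) with hT
  have hT50 : T ≤ 50 * #(Nat.smoothNumbersUpTo ⌊x⌋₊ (y + 1)) := by linarith
  have hxα : x ^ α ≠ 0 := (Real.rpow_pos_of_pos hx0 α).ne'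
  have hsplit : x' ^ α * smoothZeta α y / Real.sqrt (saddlePhi₂ α y) = (x' / x) ^ α * T := by
    rw [hT, Real.div_rpow hx'0.le hx0.le]
    field_simp
  have hq0 : 0 ≤ (x' / x) ^ α := Real.rpow_nonneg (by positivity) α
  calc (#(Nat.smoothNumbersUpTo ⌊x'⌋₊ (y + 1)) : ℝ)
      ≤ C * (x' ^ α * smoothZeta α y / Real.sqrt (saddlePhi₂ α y)) := h1
    _ = C * (x' / x) ^ α * T := by rw [hsplit]; ring
    _ ≤ C * (x' / x) ^ α * (50 * #(Nat.smoothNumbersUpTo ⌊x⌋₊ (y + 1))) :=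
        mul_le_mul_of_nonneg_left hT50 (by positivity)
    _ = 50 * C * (x' / x) ^ α * #(Nat.smoothNumbersUpTo ⌊x⌋₊ (y + 1)) := by ring

end Literature.NumberTheory.Sieve

end
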